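import Literature.MathematicalPhysics.QuantumFieldTheory.Balaban1983to89.T4CouplingMatching

/-!
# `Balaban1983to89.T4BetaMemory` — row T4-U2.R of the uniqueness spine (cell `pub-balaban`, T4-DAG v2 §5; node U2,
NE4's residual content): WHY the scale shift of the remainder `β¹` should gain a geometric factor `θ^j`, and where the
FADING MEMORY of the coupling-history moduli would come from — reduced, by ONE forward renewal inequality
(kernel-checked arithmetic), to one-step inputs; plus the kernel witnesses that WITHOUT a contracting memory, or with
merely asymptotically-free-small (non-summable) scale shifts, NO rate follows (the Gawȩdzki–Kupiainen hazard of the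
cell's T4-DAG row text made precise).  HYPOTHESIS SHAPES + BOOKKEEPING ONLY.

HONEST FRAMING (T4-DAG PAGE 1).  The cell's T4 target is rung (B)+1 — existence AND uniqueness of the ε → 0 limit of
Bałaban's unit-scale averaged expectations on a FIXED finite torus; NOT infinite volume, NOT a mass gap, NOT the Clay
problem.  Node U2 (tree `T4CouplingMatching`, unit pv16) matches the running couplings of two runs of
[Balaban1987RG1] (0.20) started at spacings ε and ε/L; its two UNPRINTED inputs are the scale-shift rate of the full
β-functions (`T4CouplingMatching.ScaleShiftRate`, split by `scaleShiftRate_of_split` into the β sub-cell's (AF-0r) for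
the coupling-free one-loop part `β⁰` and `T4CouplingMatching.RemainderShiftRate` for the remainder `β¹`) and the history
moduli with fading memory (`T4CouplingMatching.HistLipschitz`, `T4CouplingMatching.FadingMemory`).  This module is the
row "T4-U2.R" scoping of those two inputs.  NOTHING here is asserted about Bałaban's β-functions: every `def … : Prop`
is a HYPOTHESIS SHAPE, every theorem is real-number bookkeeping.  Value = the located reduction (which one-step inputs,
which smallness) + the no-rate witnesses; NOT summit progress.

WHAT PRINT SAYS (read by this seat on the ×2 journal-page renders `b2b-balaban-ref1/pages/1987-cmp109-rg-I-small-field/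
…-p008/p020/p049/p050-x2.png` and `…/1988-cmp119-convergent-renormalization/…-p020/p021-x2.png`; the manuscripts are
UNDER ADJUDICATION and are quoted for what they STATE, never as establishing a disputed step):
* [Balaban1987RG1] p. 256 (0.20) *"1/g_k² = 1/g²_{k+1} + β_{k+1}(g_k)"*; (0.22)–(0.23) *"The function E_k depends also on
  the effective coupling constants g₀, …, g_{k−1}. It is a sum of contributions coming from the k successive integrations
  in the k renormalization transformations. … In the second step a new expression of this type is created, in the old
  only a background field is changed. Thus we obtain after k steps E_k(U_k) = Σ_{j=1}^{k} [−β_j(g_{j−1})A^η(U_k) +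
  E^{(j)}(U_k)]. (0.23)"*.
* [Balaban1987RG1] p. 268 (2.12)–(2.14): the new term of the action is *"E^{(k+1)}(g_k, U_{k+1}) = log ∫dμ_{C^{(k)}}(B)χ_k
  exp[P^{(k)}(g_k, U_{k+1}, B) + {…}]. (2.13)"*, where every term of (2.12) carries the rescaled fluctuation field `g_kCB`
  and the curly bracket is *"{E_k(U_k(exp i[g_kCB − hD̃(g_kCB)]V^{(k)})) − E_k(U_k(V^{(k)}))}"*; *"Let us remark that the
  expression under the exponential above vanishes at g_k = 0, and log N″_k = E^{(k+1)}(g_k, 1). (2.14)"*; (2.15) *"with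
  the β-function defined by the formulas (1.20), (1.22) for j = k"*.  STRUCTURAL CONSEQUENCE used below (a reading of
  the displayed formula, [analysis]): the couplings g₀, …, g_{k−1} enter E^{(k+1)}, hence β_{k+1}, ONLY through the
  previous action E_k inside the curly bracket, i.e. only through the brackets `[−β_jA + E^{(j)}]`, j ≤ k, of (0.23).
* [Balaban1987RG1] p. 297 (5.42) *"β = −(∂²/∂p₁∂p₂ Π₁₂)(0) = −(∂²/∂p_μ∂p_ν Π_μν)(0) = Σ_x Π_μν(x)x_μx_ν (5.42) for μ ≠ ν.
  This is the fundamental equality defining the β-function."*; (5.44) as printed *"|Π′_{μν,κλρ}(x − y)| ≤ O(1)E₀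
  exp(½δ₁|x − y|). (5.44)"* bounds the THIRD-ORDER coefficients Π′ of (5.37)–(5.38) (sign of the exponent misprinted;
  cell GAPS G-t4-U2-3) — it is NOT a bound on β; p. 298 *"We write β_j as explicitly dependent on g_{j−1}, although it
  depends also on all preceding coupling constants. The dependence on g_{j−1} is important and it determines main
  properties of the renormalization group equations."*
* [Balaban1988Convergent] Theorem 2 p. 263 (2.43): *"there exists a constant E₁ independent of j, k, Ω, {Ω_j}, {Λ_j}, T
  (but dependent on the other constants occurring in the formulation of this theorem), such that |Σ_{z∈Λ_j⁰∩Ω}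
  [E^{(j)}(Λ_j, U_k, z) − E^{(j)}(Λ_j, 1, z)] − β_j(g_{j−1})A(φ, U_k)| ≤ E₁ Σ_{n=j}^{k} (L^{j−n})^β |Γ_n∩Ω| , (2.43) for
  β < 1, and sufficiently regular configurations U_k = U_k(V) … The constant E₁ depends on β also, and grows to ∞ if
  β → 1."* — the ONLY printed contraction of old-scale content: a SIZE bound for the renormalised scale-j bracket
  evaluated on regular scale-k backgrounds, factor `(L^{−β})^{n−j}`; p. 262 *"the newly created expressions E^{(k)},
  R^{(k)}, B^{(k)} are defined on slightly larger spaces … and they have better decay properties"*; and p. 262, after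
  Theorem 1: *"For a given index k we introduce the space of all densities satisfying the conditions of the inductive
  assumption. The theorem states that the operation RT transforms the space with the index k into the space with the
  index k + 1. This generalization does not seem to be useful, or interesting now."* — the map-between-spaces
  formulation, in which a modulus of continuity of one renormalization step (the FUNCTIONAL MEMORY below) would be
  stated, is named by the author and set aside.
NOT PRINTED anywhere in [Balaban1987RG1], [Balaban1988RG2Cluster], [Balaban1988Convergent] (cell records
`t4/T4-XREAD-U2.md` §3, `t4/T4-XREAD-U3.md`, `t4/T4-EST-U3.md`; GAPS G-t4-U2-1, G-t4-U2-2, G-t4-U3-1, G-t4-U3-3): any dependence of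
β_{k+1} on k beyond "defined for each k", any comparison of objects built at two lattice spacings (cell NE2, NE3, NE5),
any MODULUS of the dependence of E^{(k+1)} or β_{k+1} on the previous brackets or on the preceding couplings (cell NE9),
any fading of that dependence with the age k − j.  (2.43) is a size bound, not a modulus.

## What is typed, and why (T4-DAG row T4-U2.R (a), (b))

(§1) THE FORWARD RENEWAL INEQUALITY (kernel).  A real sequence with `s_j ≤ a ρ^j + Σ_{i<j} M_{j,i} s_i` and GEOMETRIC
MEMORY `0 ≤ M_{j,i} ≤ C ω^{j−i}` obeys `s_j ≤ a(ρ − ω)(ρ − (1+C)ω)⁻¹ ρ^j` PROVIDED `(1 + C)ω < ρ`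
(`renewal_geometric`; abstract weighted form `renewal_weighted`).  This is the arithmetic of "influence of old scales
does not accumulate": the memory must contract FASTER than its own prefactor allows to pile up.  In an L-block scheme
ω = L^{−β} is at one's disposal (L large) only if C is L-uniform — for Bałaban's E₁ of (2.43) print says "dependent on
the other constants occurring in the formulation", L among them (cell GAPS G-t4-U2R-2: located, undecidable from print).

(§2) NO RATE WITHOUT THESE INPUTS (kernel witnesses).  `constMemory_witness`: with NON-contracting memory (ω = 1) the
recursion is satisfied WITH EQUALITY by `a(1 + C)^j` — no decay can follow from the recursion alone.  `harmonicDisc`: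
the backward accumulation `δ_j = δ_{j+1} + c/(j+1)`, `δ_K = 0` — the equality case of node U2's `disc_step` with zero
feedback and scale shifts of the size of a two-loop term along an asymptotically free trajectory (`g_j² ~ 1/(bj)`,
[Balaban1987RG1] (0.20) with β ≥ b > 0), i.e. what the printed k-UNIFORM remainder bounds give at best (tree
`Beta.RemainderChain.RemainderConst`: |β¹| ≤ ε₁K_rem; (AF-1): |β¹_{k+1}| ≤ C g_k) — has `δ^{(K)}_0 → ∞`
(`harmonicDisc_zero_tendsto`, the harmonic series), stays ≥ c/2 at the recent scales j = K/2
(`harmonicDisc_recent_lower`), and satisfies NO `T4CauchySum.InjectedRate C e θ` with θ < 1, for any polynomial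
allowance e (`not_injectedRate_harmonicDisc`).  This is the cell's reading of the Gawȩdzki–Kupiainen hazard
([GawedzkiKupiainen1985] (142)–(143) p. 20: the marginal direction does not contract — *"δg_Λ̃ = δg_Λ g²_Λ̃/g²_Λ.
(143) Thus the initial δg_Λ has to be smaller than, say, 𝒪(g_Λ^{3+ε}) to produce |δg_Λ̃| ≤ 𝒪(g_Λ^{1+ε}g²_Λ̃), which
is integrable over log Λ > log Λ̃"*, and *"taking g^Λ given by the leading logarithms approximation would produce
δg_Λ = 𝒪(g³_Λ), which would be insufficient"* (render `b2b-balaban-t4-lit-g2/renders/gk1985/gk1985-cmp102-p020-x2.png`,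
read by this seat); cell record
`t4/T4-LITERATURE-APP-GK1985.md` row U2/NE4) transposed to the IR-pinned matching: smallness of the scale shift is not
enough, it must be SUMMABLE backward, and geometric is what node U2 typed.

(§3) THE TWO BRIDGES TO NODE U2's SHAPES (hypothesis shapes + bookkeeping).  (a) `ShiftDecomposition` — the scale
shift of β¹ at matched couplings is bounded by a one-step source (η-rate of the step-k objects at FIXED previous
action: propagators NE2/node U1a, minimisers NE3/node U1b, the Wilson vertices on the η-lattice, and run B's unpartnered
finest bracket weighted by its age) plus the memory-weighted discrepancies `s_i` of the previous brackets, which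
themselves obey `DataRenewal` (the same decomposition one level down, node U3's NE5 at fixed arguments being its
output); under geometric sources, `FadingMemory`-shaped functional memory and `(1 + C)ω < ρ` this gives
`T4CouplingMatching.RemainderShiftRate S c₁ ρ γ` with an explicit `c₁` (`remainderShiftRate_of_memory`).
(b) `ModuliDecomposition` + `ModuliRenewal` — the history modulus `Λ k i` of β_{k+1} in g_i is bounded by a direct
last-coupling modulus (i = k; the p. 264 clause "uniformly bounded … together with all derivatives" is its printed
qualitative form) plus the memory-weighted moduli of the brackets j ∈ [i, k), which obey the renewal (g_i enters bracket
j > i only through older brackets: the structural consequence of (2.13) above); this gives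
`T4CouplingMatching.FadingMemory C_Λ ρ Λ` with explicit `C_Λ` (`fadingMemory_of_moduliRenewal`).  BOTH (a) and (b) rest
on the SAME unprinted input — a MODULUS version of the (2.43) contraction for the dependence of the step-k output on the
scale-j bracket, `M_{k,j} ≤ C ω^{k−j}` — and on the smallness `(1 + C)ω < ρ < 1`.  Neither is printed; the cell record
`t4/T4-EST-U2R.md` carries the paper-level sketch and the GAPS rows (G-t4-U2R-1…-4).

CITATION HEADER (lean-in-tree rule 2026-08-18).  T. Bałaban, *Renormalization group approach to lattice gauge field
theories. I*, Commun. Math. Phys. **109**, 249–301 (1987) [Balaban1987RG1] (cell paper B12 = [I]; held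
`paper:balaban1987-cmp109-rg-i-small-field`; journal page = PDF page + 248); T. Bałaban, *Convergent renormalization
expansions for lattice gauge theories*, Commun. Math. Phys. **119**, 243–285 (1988) [Balaban1988Convergent] (B14 =
[III]; journal page = PDF page + 242); K. Gawȩdzki, A. Kupiainen, *Gross–Neveu model through convergent perturbation
expansions*, Commun. Math. Phys. **102**, 1–30 (1985) [GawedzkiKupiainen1985] (PUBLISHED, outside the audited series;
cell record `t4/T4-LITERATURE-APP-GK1985.md`, renders `b2b-balaban-t4-lit-g2/renders/gk1985/`).  NEW module of unit
`b2b-balaban-pv20-g3` (SURGE NODE PROVER #20 gen 3; journal claim T4-U2.R 2026-08-18T20:49:50Z); imports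
`T4CouplingMatching` (hence `FlowStep`, `B12Beta`, `T4CauchySum`) and modifies nothing; no `sorry`, no `axiom`.
-/

namespace Literature.MathematicalPhysics.QuantumFieldTheory.Balaban1983to89.T4BetaMemory

open Literature.MathematicalPhysics.QuantumFieldTheory.Balaban1983to89
open Literature.MathematicalPhysics.QuantumFieldTheory.Balaban1983to89.FlowStep
open Literature.MathematicalPhysics.QuantumFieldTheory.Balaban1983to89.T4CouplingMatching
open Finset Filter Topology

/-! ## §1 The forward renewal inequality with fading memory (kernel-checked arithmetic) -/

/-- **FORWARD RENEWAL, WEIGHTED FORM.**  If `s_j ≤ src_j + Σ_{i<j} mem_{j,i}·s_i` with `mem ≥ 0`, sources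
`src_j ≤ a ρ^j` (`a ≥ 0`) and the ρ-weighted row sums satisfy `Σ_{i<j} mem_{j,i} ρ^i ≤ q ρ^j` with `q < 1`, then
`s_j ≤ a(1 − q)⁻¹ ρ^j` for every j (strong induction; no sign condition on `s`).  The abstract form of "the influence
of old scales does not accumulate". [folklore] -/
theorem renewal_weighted {s src : ℕ → ℝ} {mem : ℕ → ℕ → ℝ} {a q ρ : ℝ} (ha : 0 ≤ a) (hq1 : q < 1)
    (hmem : ∀ j i, i < j → 0 ≤ mem j i) (hsrc : ∀ j, src j ≤ a * ρ ^ j)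
    (hrow : ∀ j, ∑ i ∈ range j, mem j i * ρ ^ i ≤ q * ρ ^ j)
    (hrec : ∀ j, s j ≤ src j + ∑ i ∈ range j, mem j i * s i) :
    ∀ j, s j ≤ a / (1 - q) * ρ ^ j := by
  have h1q : (0 : ℝ) < 1 - q := sub_pos.mpr hq1
  set D := a / (1 - q) with hD
  have hD0 : 0 ≤ D := div_nonneg ha h1q.le
  have hDq : a + q * D = D := by
    rw [hD]
    field_simp
    ring
  intro j
  refine Nat.strong_induction_on j fun j ih => ?_
  have hsum : ∑ i ∈ range j, mem j i * s i ≤ ∑ i ∈ range j, mem j i * (D * ρ ^ i) := by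
    refine Finset.sum_le_sum fun i hi => ?_
    have hij : i < j := mem_range.mp hi
    exact mul_le_mul_of_nonneg_left (ih i hij) (hmem j i hij)
  have hfac : ∑ i ∈ range j, mem j i * (D * ρ ^ i) = D * ∑ i ∈ range j, mem j i * ρ ^ i := by
    rw [Finset.mul_sum]
    exact Finset.sum_congr rfl fun i _ => by ring
  have hDrow : D * ∑ i ∈ range j, mem j i * ρ ^ i ≤ D * (q * ρ ^ j) :=
    mul_le_mul_of_nonneg_left (hrow j) hD0
  calc s j ≤ src j + ∑ i ∈ range j, mem j i * s i := hrec j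
    _ ≤ a * ρ ^ j + D * (q * ρ ^ j) := by
        rw [hfac] at hsum
        exact add_le_add (hsrc j) (hsum.trans hDrow)
    _ = (a + q * D) * ρ ^ j := by ring
    _ = D * ρ ^ j := by rw [hDq]

/-- The geometric row sum: for `0 ≤ ω < ρ`, `Σ_{i<j} ω^{j−i} ρ^i ≤ ω(ρ − ω)⁻¹ ρ^j`. [folklore] -/
theorem geom_row_sum {ω ρ : ℝ} (hω : 0 ≤ ω) (hωρ : ω < ρ) :
    ∀ j, ∑ i ∈ range j, ω ^ (j - i) * ρ ^ i ≤ ω / (ρ - ω) * ρ ^ j := by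
  have hρ : 0 < ρ := lt_of_le_of_lt hω hωρ
  have hρω : 0 < ρ - ω := sub_pos.mpr hωρ
  intro j
  induction j with
  | zero =>
      simp only [Finset.range_zero, Finset.sum_empty, pow_zero, mul_one]
      exact div_nonneg hω hρω.le
  | succ j ih =>
      rw [Finset.sum_range_succ]
      have e1 : ∑ i ∈ range j, ω ^ (j + 1 - i) * ρ ^ i = ω * ∑ i ∈ range j, ω ^ (j - i) * ρ ^ i := by
        rw [Finset.mul_sum]
        refine Finset.sum_congr rfl fun i hi => ?_
        have hij : i < j := mem_range.mp hi
        rw [show j + 1 - i = (j - i) + 1 by omega, pow_succ]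
        ring
      have e2 : ω ^ (j + 1 - j) * ρ ^ j = ω * ρ ^ j := by
        rw [show j + 1 - j = 1 by omega, pow_one]
      rw [e1, e2]
      have h3 : ω * ∑ i ∈ range j, ω ^ (j - i) * ρ ^ i ≤ ω * (ω / (ρ - ω) * ρ ^ j) :=
        mul_le_mul_of_nonneg_left ih hω
      have key : ω * (ω / (ρ - ω) * ρ ^ j) + ω * ρ ^ j = ω / (ρ - ω) * ρ ^ (j + 1) := by
        rw [pow_succ]
        field_simp
        ring
      linarith [key]

/-- **FORWARD RENEWAL WITH GEOMETRIC (FADING) MEMORY.**  If `s_j ≤ a ρ^j + Σ_{i<j} M_{j,i} s_i` with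
`0 ≤ M_{j,i} ≤ C ω^{j−i}` (`a, C, ω ≥ 0`) and the SMALLNESS `(1 + C)ω < ρ` holds, then
`s_j ≤ a(ρ − ω)(ρ − (1+C)ω)⁻¹ ρ^j` for every j.  With memory rate ω = L^{−β} the smallness is "L large" ONLY IF C is
L-uniform; with `ρ ≤ ω(1 + C)` nothing follows (`constMemory_witness` is the case ω = ρ = 1). [folklore] -/
theorem renewal_geometric {s : ℕ → ℝ} {M : ℕ → ℕ → ℝ} {a C ω ρ : ℝ} (ha : 0 ≤ a) (hC : 0 ≤ C) (hω : 0 ≤ ω)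
    (hsmall : (1 + C) * ω < ρ) (hM : ∀ j i, i < j → 0 ≤ M j i ∧ M j i ≤ C * ω ^ (j - i))
    (hrec : ∀ j, s j ≤ a * ρ ^ j + ∑ i ∈ range j, M j i * s i) :
    ∀ j, s j ≤ a * (ρ - ω) / (ρ - (1 + C) * ω) * ρ ^ j := by
  have hωρ : ω < ρ := by nlinarith
  have hρω : 0 < ρ - ω := sub_pos.mpr hωρ
  have hρ0 : 0 ≤ ρ := (lt_of_le_of_lt hω hωρ).le
  set q := C * ω / (ρ - ω) with hq
  have hq1 : q < 1 := by
    rw [hq, div_lt_one hρω]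
    linarith
  have hrow : ∀ j, ∑ i ∈ range j, M j i * ρ ^ i ≤ q * ρ ^ j := by
    intro j
    calc ∑ i ∈ range j, M j i * ρ ^ i ≤ ∑ i ∈ range j, C * ω ^ (j - i) * ρ ^ i :=
          Finset.sum_le_sum fun i hi =>
            mul_le_mul_of_nonneg_right (hM j i (mem_range.mp hi)).2 (pow_nonneg hρ0 i)
      _ = C * ∑ i ∈ range j, ω ^ (j - i) * ρ ^ i := by
          rw [Finset.mul_sum]
          exact Finset.sum_congr rfl fun i _ => by ring
      _ ≤ C * (ω / (ρ - ω) * ρ ^ j) := mul_le_mul_of_nonneg_left (geom_row_sum hω hωρ j) hC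
      _ = q * ρ ^ j := by rw [hq]; ring
  have h := renewal_weighted (src := fun j => a * ρ ^ j) ha hq1 (fun j i hij => (hM j i hij).1)
    (fun j => le_rfl) hrow hrec
  have e : a / (1 - q) = a * (ρ - ω) / (ρ - (1 + C) * ω) := by
    rw [hq, one_sub_div hρω.ne', div_div_eq_mul_div]
    congr 1
    ring
  intro j
  rw [← e]
  exact h j

/-- Sources of a slower geometric rate can always be read at the target rate: `θ ≤ ρ`, `0 ≤ θ` ⇒ `θ^j ≤ ρ^j`.
[folklore] -/
theorem pow_le_pow_of_rate {θ ρ : ℝ} (hθ : 0 ≤ θ) (hθρ : θ ≤ ρ) (j : ℕ) : θ ^ j ≤ ρ ^ j :=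
  pow_le_pow_left₀ hθ hθρ j

/-! ## §2 No rate without a contracting memory or without summable sources (kernel witnesses) -/

/-- **CONSTANT MEMORY PERMITS EXPONENTIAL GROWTH.**  The sequence `a(1 + C)^j` satisfies the renewal recursion with
NON-contracting memory `M ≡ C` and constant sources `a` WITH EQUALITY: `a(1+C)^j = a + Σ_{i<j} C·a(1+C)^i`.  Hence no
decay (indeed no bound) follows from `s_j ≤ a + Σ_{i<j} C s_i` alone — the contraction `ω < 1` AND the smallness
`(1 + C)ω < ρ` of `renewal_geometric` are load-bearing. [folklore] -/
theorem constMemory_witness (a C : ℝ) :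
    ∀ j, a * (1 + C) ^ j = a + ∑ i ∈ range j, C * (a * (1 + C) ^ i) := by
  intro j
  induction j with
  | zero => simp
  | succ j ih =>
      rw [Finset.sum_range_succ, ← add_assoc, ← ih]
      ring

/-- … and for `a > 0`, `C > 0` that solution is unbounded. [folklore] -/
theorem constMemory_witness_unbounded {a C : ℝ} (ha : 0 < a) (hC : 0 < C) :
    Tendsto (fun j : ℕ => a * (1 + C) ^ j) atTop atTop :=
  Tendsto.const_mul_atTop ha (tendsto_pow_atTop_atTop_of_one_lt (by linarith))

/-- THE HARMONIC BACKWARD ACCUMULATION (the Gawȩdzki–Kupiainen hazard of the row text, transposed to node U2's IR-pinned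
matching): `δ^{(K)}_j = Σ_{i∈[j,K)} c/(i+1)` — scale shifts of two-loop size `c/(i+1) ~ c′g_i²` along an asymptotically
free trajectory, accumulated backward from the pinning `δ_K = 0` with NO feedback. [cite: GawedzkiKupiainen1985, (142)-(143) p.20] -/
noncomputable def harmonicDisc (c : ℝ) (K j : ℕ) : ℝ := ∑ i ∈ Ico j K, c / ((i : ℝ) + 1)

/-- Pinning: `δ^{(K)}_K = 0` (as `T4CouplingMatching.disc_pin`). [folklore] -/
theorem harmonicDisc_pin (c : ℝ) (K : ℕ) : harmonicDisc c K K = 0 := by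
  simp [harmonicDisc]

/-- The recursion: for `j < K`, `δ_j = δ_{j+1} + c/(j+1)` — the EQUALITY case of `T4CouplingMatching.disc_step` with the
scale-shift term `c/(j+1)` in place of `cθ^j` and zero history feedback. [folklore] -/
theorem harmonicDisc_step (c : ℝ) {K j : ℕ} (hj : j < K) :
    harmonicDisc c K j = harmonicDisc c K (j + 1) + c / ((j : ℝ) + 1) := by
  unfold harmonicDisc
  rw [Finset.sum_eq_sum_Ico_succ_bot hj]
  ring

/-- Nonnegativity for `c ≥ 0`. [folklore] -/
theorem harmonicDisc_nonneg {c : ℝ} (hc : 0 ≤ c) (K j : ℕ) : 0 ≤ harmonicDisc c K j :=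
  Finset.sum_nonneg fun i _ => div_nonneg hc (by positivity)

/-- Each source is uniformly small (`≤ c`), exactly like a k-uniform remainder bound `|β¹_{k+2} − β¹_{k+1}| ≤ 2r`
(tree `Beta.RemainderChain.RemainderConst`) — smallness that does NOT decay. [folklore] -/
theorem harmonicDisc_source_le {c : ℝ} (hc : 0 ≤ c) (j : ℕ) : c / ((j : ℝ) + 1) ≤ c :=
  div_le_self hc (by linarith [(Nat.cast_nonneg j : (0 : ℝ) ≤ j)])

/-- At the coarsest scale the accumulation is `c` times the harmonic sum. [folklore] -/
theorem harmonicDisc_zero (c : ℝ) (K : ℕ) :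
    harmonicDisc c K 0 = c * ∑ i ∈ range K, (1 / ((i : ℝ) + 1)) := by
  unfold harmonicDisc
  rw [Nat.Ico_zero_eq_range, Finset.mul_sum]
  exact Finset.sum_congr rfl fun i _ => by ring

/-- **DIVERGENCE (the hazard).**  For `c > 0`, `δ^{(K)}_0 → ∞` as the number of steps K → ∞ (harmonic series): merely
AF-small, non-summable scale shifts give NO K-uniform coupling matching. [folklore] -/
theorem harmonicDisc_zero_tendsto {c : ℝ} (hc : 0 < c) :
    Tendsto (fun K => harmonicDisc c K 0) atTop atTop := by
  have h := (Real.tendsto_sum_range_one_div_nat_succ_atTop).const_mul_atTop hc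
  exact h.congr fun K => (harmonicDisc_zero c K).symm

/-- Hence no K-uniform bound at the coarsest scale. [folklore] -/
theorem harmonicDisc_not_bounded {c : ℝ} (hc : 0 < c) : ¬ ∃ D : ℝ, ∀ K, harmonicDisc c K 0 ≤ D := by
  rintro ⟨D, hD⟩
  have h := harmonicDisc_zero_tendsto hc
  rw [Filter.tendsto_atTop_atTop] at h
  obtain ⟨N, hN⟩ := h (D + 1)
  linarith [hN N le_rfl, hD N]

/-- **RECENT SCALES DO NOT IMPROVE EITHER.**  At `j = K/2` the accumulation stays `≥ c/2` for every K = 2m ≥ 2: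
`Σ_{i=m}^{2m−1} c/(i+1) ≥ m · c/(2m)`.  So the discrepancy at the scales that carry the O(1) recent structure does not
tend to zero — contrast `T4CouplingMatching.disc_le_of_fadingMemory`'s `(2c/(1−θ))θ^j`. [folklore] -/
theorem harmonicDisc_recent_lower {c : ℝ} (hc : 0 ≤ c) {m : ℕ} (hm : 1 ≤ m) :
    c / 2 ≤ harmonicDisc c (2 * m) m := by
  unfold harmonicDisc
  have hm0 : (m : ℝ) ≠ 0 := by exact_mod_cast (show m ≠ 0 by omega)
  have hcard : (Ico m (2 * m)).card = m := by
    rw [Nat.card_Ico]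
    omega
  have hterm : ∀ i ∈ Ico m (2 * m), c / (2 * (m : ℝ)) ≤ c / ((i : ℝ) + 1) := by
    intro i hi
    have hi2 : i + 1 ≤ 2 * m := (mem_Ico.mp hi).2
    have hcast : (i : ℝ) + 1 ≤ 2 * (m : ℝ) := by exact_mod_cast hi2
    exact div_le_div_of_nonneg_left hc (by positivity) hcast
  calc c / 2 = ∑ _i ∈ Ico m (2 * m), c / (2 * (m : ℝ)) := by
        rw [Finset.sum_const, hcard, nsmul_eq_mul]
        field_simp
    _ ≤ ∑ i ∈ Ico m (2 * m), c / ((i : ℝ) + 1) := Finset.sum_le_sum hterm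

/-- **… AND NO `InjectedRate` HOLDS.**  For `c > 0` and any `θ ∈ [0,1[`, any constant `C` and any polynomial allowance
`e`, the harmonic accumulation violates the node-U2 output shape `T4CauchySum.InjectedRate C e θ`
(`δ^{(K)}_j ≤ C (K+1)^e θ^j`): at `K = 2m`, `j = m` the right side tends to 0 while the left side stays ≥ c/2.
The located moral for row T4-U2.R (a): a k-uniform or merely AF-small bound on the scale shift of β¹ cannot feed the
spine; a SUMMABLE (here: geometric) rate is needed. [folklore] -/
theorem not_injectedRate_harmonicDisc {c C θ : ℝ} (hc : 0 < c) (hθ0 : 0 ≤ θ) (hθ1 : θ < 1) (e : ℕ) :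
    ¬ T4CauchySum.InjectedRate C e θ (harmonicDisc c) := by
  intro h
  have hθabs : |θ| < 1 := abs_lt.mpr ⟨by linarith, hθ1⟩
  -- the right-hand side at K = 2m, j = m is ≤ |C|·3^e·(m^e θ^m) → 0
  have hT : Tendsto (fun m : ℕ => |C| * 3 ^ e * ((m : ℝ) ^ e * θ ^ m)) atTop (𝓝 0) := by
    simpa using (tendsto_pow_const_mul_const_pow_of_abs_lt_one e hθabs).const_mul (|C| * 3 ^ e)
  have hev : ∀ᶠ m : ℕ in atTop, |C| * 3 ^ e * ((m : ℝ) ^ e * θ ^ m) < c / 2 :=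
    hT.eventually (eventually_lt_nhds (by linarith))
  obtain ⟨m, hm1, hm2⟩ := ((eventually_ge_atTop 1).and hev).exists
  have hlow : c / 2 ≤ harmonicDisc c (2 * m) m := harmonicDisc_recent_lower hc.le hm1
  have hup : harmonicDisc c (2 * m) m ≤ C * (((2 * m : ℕ) : ℝ) + 1) ^ e * θ ^ m := (h (2 * m) m (by omega)).2
  have hX0 : 0 ≤ (((2 * m : ℕ) : ℝ) + 1) ^ e * θ ^ m := by positivity
  have hX1 : (((2 * m : ℕ) : ℝ) + 1) ^ e ≤ (3 : ℝ) ^ e * (m : ℝ) ^ e := by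
    rw [← mul_pow]
    apply pow_le_pow_left₀ (by positivity)
    have : (1 : ℝ) ≤ m := by exact_mod_cast hm1
    push_cast
    linarith
  have hbound : C * (((2 * m : ℕ) : ℝ) + 1) ^ e * θ ^ m ≤ |C| * 3 ^ e * ((m : ℝ) ^ e * θ ^ m) := by
    calc C * (((2 * m : ℕ) : ℝ) + 1) ^ e * θ ^ m
        = C * ((((2 * m : ℕ) : ℝ) + 1) ^ e * θ ^ m) := by ring
      _ ≤ |C| * ((((2 * m : ℕ) : ℝ) + 1) ^ e * θ ^ m) := mul_le_mul_of_nonneg_right (le_abs_self C) hX0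
      _ ≤ |C| * ((3 : ℝ) ^ e * (m : ℝ) ^ e * θ ^ m) :=
          mul_le_mul_of_nonneg_left (mul_le_mul_of_nonneg_right hX1 (pow_nonneg hθ0 m)) (abs_nonneg C)
      _ = |C| * 3 ^ e * ((m : ℝ) ^ e * θ ^ m) := by ring
  linarith

/-! ## §3 The two bridges to node U2's hypothesis shapes -/

/-- Memory-weighted sums of geometrically bounded quantities: `FadingMemory C ω M` (tree shape, node U2), `0 ≤ ω < ρ`,
`t_i ≤ D ρ^i` for `i < k` with `D ≥ 0` ⇒ `Σ_{i<k} M_{k,i} t_i ≤ C·D·ω(ρ − ω)⁻¹ ρ^k`. [folklore] -/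
theorem memSum_le {M : ℕ → ℕ → ℝ} {C ω ρ D : ℝ} {t : ℕ → ℝ} (hM : FadingMemory C ω M) (hC : 0 ≤ C)
    (hω : 0 ≤ ω) (hωρ : ω < ρ) (hD : 0 ≤ D) (k : ℕ) (ht : ∀ i, i < k → t i ≤ D * ρ ^ i) :
    ∑ i ∈ range k, M k i * t i ≤ C * D * (ω / (ρ - ω)) * ρ ^ k := by
  have hρ0 : 0 ≤ ρ := (lt_of_le_of_lt hω hωρ).le
  calc ∑ i ∈ range k, M k i * t i ≤ ∑ i ∈ range k, C * ω ^ (k - i) * (D * ρ ^ i) := by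
        refine Finset.sum_le_sum fun i hi => ?_
        have hik : i < k := mem_range.mp hi
        obtain ⟨hM0, hM1⟩ := hM k i hik.le
        calc M k i * t i ≤ M k i * (D * ρ ^ i) := mul_le_mul_of_nonneg_left (ht i hik) hM0
          _ ≤ C * ω ^ (k - i) * (D * ρ ^ i) :=
              mul_le_mul_of_nonneg_right hM1 (mul_nonneg hD (pow_nonneg hρ0 i))
    _ = C * D * ∑ i ∈ range k, ω ^ (k - i) * ρ ^ i := by
        rw [Finset.mul_sum]
        exact Finset.sum_congr rfl fun i _ => by ring
    _ ≤ C * D * (ω / (ρ - ω) * ρ ^ k) :=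
        mul_le_mul_of_nonneg_left (geom_row_sum hω hωρ k) (mul_nonneg hC hD)
    _ = C * D * (ω / (ρ - ω)) * ρ ^ k := by ring

/-- HYPOTHESIS SHAPE (structural, NOT PRINTED — row T4-U2.R (a)): SHIFT DECOMPOSITION of the remainder.  The scale
shift of `β¹` at infrared-matched couplings — run B's (k+1)-th step (`S.β1 (k+1) w`, spacing η/L, one more finest
coupling `w 0`) against run A's k-th step (`S.β1 k (Fin.tail w)`) — is bounded by a ONE-STEP SOURCE `src k` (the
η-rate of the step-k objects at FIXED previous action: covariance and propagators C^{(k)}, G_k, H₁ of (2.12) — cell NE2,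
node U1a; minimisers U_{k+1}(V) — NE3, node U1b; the coefficients V, G₃, D̃, σ of the Wilson action on the η-lattice —
elementary; and run B's unpartnered finest bracket weighted by its age k+1) PLUS the memory-weighted discrepancies
`s i` of the previous brackets `[−β_{i+1}A + E^{(i+1)}]`, `i < k`, of (0.23) between the two runs (node U3's objects,
`T4OutputRate.NE5` at fixed transported arguments), with FUNCTIONAL MEMORY `M k i` = the modulus of the dependence of the
step-k output through the curly bracket of (2.13) on the scale-i bracket.  Words only; nothing of (2.12) is modelled.
[cite: Balaban1987RG1, (2.12)-(2.15) p.268 and (0.23) p.256] -/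
def ShiftDecomposition {β : HBeta} (S : B12Beta.OneLoopSplit β) (γ : ℝ) (src : ℕ → ℝ) (M : ℕ → ℕ → ℝ)
    (s : ℕ → ℝ) : Prop :=
  ∀ k (w : Fin (k + 2) → ℝ), w ∈ Box γ (k + 1) →
    |S.β1 (k + 1) w - S.β1 k (Fin.tail w)| ≤ src k + ∑ i ∈ range k, M k i * s i

/-- HYPOTHESIS SHAPE (structural, NOT PRINTED): DATA RENEWAL — the discrepancy `s j` of the scale-j brackets of the two
runs obeys the same decomposition one level down: a one-step source `src' j` plus the memory-weighted discrepancies of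
the older brackets (the step-j integral (2.13) sees g₀, …, g_{j−1} and the older brackets only through E_j in its curly
bracket — the structural reading of (2.12)). [cite: Balaban1987RG1, (2.13) p.268] -/
def DataRenewal (src' : ℕ → ℝ) (M' : ℕ → ℕ → ℝ) (s : ℕ → ℝ) : Prop :=
  ∀ j, s j ≤ src' j + ∑ i ∈ range j, M' j i * s i

/-- **BRIDGE (a): `RemainderShiftRate` FROM ONE-STEP RATES + FADING FUNCTIONAL MEMORY + SMALLNESS.**  Under
`DataRenewal src' M' s` with geometric sources `src' j ≤ a ρ^j`, memory `FadingMemory C' ω M'` and `(1 + C')ω < ρ`,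
and `ShiftDecomposition S γ src M s` with `src k ≤ b ρ^k`, `FadingMemory C ω M`: the node-U2 input
`T4CouplingMatching.RemainderShiftRate S c₁ ρ γ` holds with
`c₁ = b + C·(a(ρ−ω)(ρ−(1+C′)ω)⁻¹)·ω(ρ−ω)⁻¹`.  Every hypothesis is an UNPRINTED input (cell NE2/NE3/NE5 for the sources,
a MODULUS form of [Balaban1988Convergent] (2.43) for the memories); the theorem is bookkeeping
(`renewal_geometric` + `memSum_le`). [cite: Balaban1988Convergent, Thm 2 (2.43) p.263] -/
theorem remainderShiftRate_of_memory {β : HBeta} {S : B12Beta.OneLoopSplit β} {γ a b C C' ω ρ : ℝ}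
    {src src' s : ℕ → ℝ} {M M' : ℕ → ℕ → ℝ}
    (ha : 0 ≤ a) (hC : 0 ≤ C) (hC' : 0 ≤ C') (hω : 0 ≤ ω) (hsmall : (1 + C') * ω < ρ) (hωρ : ω < ρ)
    (hren : DataRenewal src' M' s) (hsrc' : ∀ j, src' j ≤ a * ρ ^ j) (hM' : FadingMemory C' ω M')
    (hdec : ShiftDecomposition S γ src M s) (hsrc : ∀ k, src k ≤ b * ρ ^ k) (hM : FadingMemory C ω M) :
    RemainderShiftRate S (b + C * (a * (ρ - ω) / (ρ - (1 + C') * ω)) * (ω / (ρ - ω))) ρ γ := by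
  -- Step 1: the bracket discrepancies decay geometrically (forward renewal).
  have hs : ∀ j, s j ≤ a * (ρ - ω) / (ρ - (1 + C') * ω) * ρ ^ j :=
    renewal_geometric ha hC' hω hsmall (fun j i hij => hM' j i hij.le)
      (fun j => (hren j).trans (add_le_add (hsrc' j) le_rfl))
  have hD0 : 0 ≤ a * (ρ - ω) / (ρ - (1 + C') * ω) :=
    div_nonneg (mul_nonneg ha (sub_pos.mpr hωρ).le) (sub_pos.mpr hsmall).le
  -- Step 2: plug into the shift decomposition.
  intro k w hw
  have h1 := hdec k w hw
  have h2 := memSum_le hM hC hω hωρ hD0 k fun i _ => hs i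
  calc |S.β1 (k + 1) w - S.β1 k (Fin.tail w)| ≤ src k + ∑ i ∈ range k, M k i * s i := h1
    _ ≤ b * ρ ^ k + C * (a * (ρ - ω) / (ρ - (1 + C') * ω)) * (ω / (ρ - ω)) * ρ ^ k :=
        add_le_add (hsrc k) h2
    _ = (b + C * (a * (ρ - ω) / (ρ - (1 + C') * ω)) * (ω / (ρ - ω))) * ρ ^ k := by ring

/-- HYPOTHESIS SHAPE (structural, NOT PRINTED — row T4-U2.R (b)): MODULI DECOMPOSITION.  The history modulus `Λ k i`
of `β_{k+1}` in the coupling `g_i` (`i ≤ k`; tree `T4CouplingMatching.HistLipschitz`) is bounded by a DIRECT modulus `ℓ`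
in the LAST coupling (i = k: every term of (2.12) carries g_kCB; the printed qualitative clause is p. 264 *"It is a
smooth function defined on the interval [0, γ], (or analytic), uniformly bounded on this interval together with all
derivatives."*) plus, for i < k, the functional-memory-weighted moduli `lam j i` of the brackets j ∈ [i, k) in g_i
(g_i, i < k, enters (2.13) only through E_k).
[cite: Balaban1987RG1, (2.12)-(2.13) p.268 and §1 p.264] -/
def ModuliDecomposition (Λ lam M : ℕ → ℕ → ℝ) (ℓ : ℝ) : Prop :=
  ∀ k i, i ≤ k → Λ k i ≤ (if i = k then ℓ else 0) + ∑ j ∈ Ico i k, M k j * lam j i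

/-- HYPOTHESIS SHAPE (structural, NOT PRINTED): MODULI RENEWAL for the brackets — the bracket born at step j depends
on its own coupling g_j directly (modulus `≤ ℓ'`) and on g_i, i < j, only through the older brackets m ∈ [i, j)
(memory `M' j m`): `lam j i ≤ Σ_{m∈[i,j)} M'_{j,m} lam m i`. [cite: Balaban1987RG1, (0.23) p.256 and (2.13) p.268] -/
def ModuliRenewal (lam M' : ℕ → ℕ → ℝ) (ℓ' : ℝ) : Prop :=
  (∀ i, lam i i ≤ ℓ') ∧ ∀ j i, i < j → lam j i ≤ ∑ m ∈ Ico i j, M' j m * lam m i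

/-- Under `ModuliRenewal lam M' ℓ'` with `FadingMemory C' ω M'` and `(1 + C')ω < ρ` (`ℓ', C', ω ≥ 0`), the bracket
moduli fade geometrically in the age: `lam j i ≤ ℓ'(ρ−ω)(ρ−(1+C′)ω)⁻¹ ρ^{j−i}` for `i ≤ j` (forward renewal in the
age `n = j − i`, sources at n = 0 only). [folklore] -/
theorem moduli_geometric {lam M' : ℕ → ℕ → ℝ} {ℓ' C' ω ρ : ℝ} (hℓ' : 0 ≤ ℓ') (hC' : 0 ≤ C') (hω : 0 ≤ ω)
    (hsmall : (1 + C') * ω < ρ) (hM' : FadingMemory C' ω M') (hren : ModuliRenewal lam M' ℓ') :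
    ∀ j i, i ≤ j → lam j i ≤ ℓ' * (ρ - ω) / (ρ - (1 + C') * ω) * ρ ^ (j - i) := by
  have hωρ : ω < ρ := by nlinarith
  have hρ0 : 0 ≤ ρ := (lt_of_le_of_lt hω hωρ).le
  intro j i hij
  -- the age-indexed system for fixed i
  set t : ℕ → ℝ := fun n => lam (i + n) i with ht
  have hrec : ∀ n, t n ≤ ℓ' * ρ ^ n + ∑ m ∈ range n, M' (i + n) (i + m) * t m := by
    intro n
    rcases Nat.eq_zero_or_pos n with hn | hn
    · subst hn
      simp only [ht, add_zero, pow_zero, mul_one, Finset.range_zero, Finset.sum_empty]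
      exact hren.1 i
    · have h := hren.2 (i + n) i (by omega)
      rw [Finset.sum_Ico_eq_sum_range] at h
      have e : i + n - i = n := by omega
      rw [e] at h
      have h0 : 0 ≤ ℓ' * ρ ^ n := mul_nonneg hℓ' (pow_nonneg hρ0 n)
      simp only [ht]
      linarith
  have hMshift : ∀ n m, m < n → 0 ≤ M' (i + n) (i + m) ∧ M' (i + n) (i + m) ≤ C' * ω ^ (n - m) := by
    intro n m hmn
    have h := hM' (i + n) (i + m) (by omega)
    have e : i + n - (i + m) = n - m := by omega
    rw [e] at h
    exact h
  have hmain := renewal_geometric hℓ' hC' hω hsmall hMshift hrec (j - i)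
  have e : i + (j - i) = j := by omega
  simp only [ht, e] at hmain
  exact hmain

/-- **BRIDGE (b): `FadingMemory` OF THE HISTORY MODULI FROM ONE-STEP DIRECT MODULI + FADING FUNCTIONAL MEMORY +
SMALLNESS.**  `ModuliDecomposition Λ lam M ℓ`, `ModuliRenewal lam M' ℓ'`, `FadingMemory C ω M`, `FadingMemory C' ω M'`,
`(1 + C')ω < ρ`, `Λ ≥ 0` (and `ℓ, ℓ', C, C', ω ≥ 0`) ⇒ `T4CouplingMatching.FadingMemory C_Λ ρ Λ` with
`C_Λ = ℓ + C·(ℓ′(ρ−ω)(ρ−(1+C′)ω)⁻¹)·ω(ρ−ω)⁻¹`.  Every hypothesis is UNPRINTED (cell NE9 / GAPS G-t4-U2-2, G-t4-U3-3);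
bookkeeping (`moduli_geometric` + `geom_row_sum`). [cite: Balaban1987RG1, §5 p.298] -/
theorem fadingMemory_of_moduliRenewal {Λ lam M M' : ℕ → ℕ → ℝ} {ℓ ℓ' C C' ω ρ : ℝ}
    (hℓ : 0 ≤ ℓ) (hℓ' : 0 ≤ ℓ') (hC : 0 ≤ C) (hC' : 0 ≤ C') (hω : 0 ≤ ω) (hsmall : (1 + C') * ω < ρ)
    (hωρ : ω < ρ) (hM : FadingMemory C ω M) (hM' : FadingMemory C' ω M') (hdec : ModuliDecomposition Λ lam M ℓ)
    (hren : ModuliRenewal lam M' ℓ') (hΛ0 : ∀ k i, i ≤ k → 0 ≤ Λ k i) :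
    FadingMemory (ℓ + C * (ℓ' * (ρ - ω) / (ρ - (1 + C') * ω)) * (ω / (ρ - ω))) ρ Λ := by
  have hρ0 : 0 ≤ ρ := (lt_of_le_of_lt hω hωρ).le
  set D := ℓ' * (ρ - ω) / (ρ - (1 + C') * ω) with hD
  have hD0 : 0 ≤ D := div_nonneg (mul_nonneg hℓ' (sub_pos.mpr hωρ).le) (sub_pos.mpr hsmall).le
  have hlam : ∀ j i, i ≤ j → lam j i ≤ D * ρ ^ (j - i) := moduli_geometric hℓ' hC' hω hsmall hM' hren
  intro k i hik
  refine ⟨hΛ0 k i hik, ?_⟩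
  have h1 := hdec k i hik
  -- the diagonal term
  have hdiag : (if i = k then ℓ else 0) ≤ ℓ * ρ ^ (k - i) := by
    split_ifs with h
    · subst h; simp
    · exact mul_nonneg hℓ (pow_nonneg hρ0 _)
  -- the memory sum, re-indexed by the age n = j - i
  have hsum : ∑ j ∈ Ico i k, M k j * lam j i ≤ C * D * (ω / (ρ - ω)) * ρ ^ (k - i) := by
    have step1 : ∑ j ∈ Ico i k, M k j * lam j i ≤ ∑ j ∈ Ico i k, C * ω ^ (k - j) * (D * ρ ^ (j - i)) := by
      refine Finset.sum_le_sum fun j hj => ?_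
      have hj' : i ≤ j ∧ j < k := mem_Ico.mp hj
      obtain ⟨hM0, hM1⟩ := hM k j hj'.2.le
      calc M k j * lam j i ≤ M k j * (D * ρ ^ (j - i)) := mul_le_mul_of_nonneg_left (hlam j i hj'.1) hM0
        _ ≤ C * ω ^ (k - j) * (D * ρ ^ (j - i)) :=
            mul_le_mul_of_nonneg_right hM1 (mul_nonneg hD0 (pow_nonneg hρ0 _))
    have step2 : ∑ j ∈ Ico i k, C * ω ^ (k - j) * (D * ρ ^ (j - i))
        = C * D * ∑ n ∈ range (k - i), ω ^ ((k - i) - n) * ρ ^ n := by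
      rw [Finset.sum_Ico_eq_sum_range, Finset.mul_sum]
      refine Finset.sum_congr rfl fun n hn => ?_
      have hn' : n < k - i := mem_range.mp hn
      have e1 : k - (i + n) = k - i - n := by omega
      have e2 : i + n - i = n := by omega
      rw [e1, e2]
      ring
    have step3 : C * D * ∑ n ∈ range (k - i), ω ^ ((k - i) - n) * ρ ^ n ≤ C * D * (ω / (ρ - ω) * ρ ^ (k - i)) :=
      mul_le_mul_of_nonneg_left (geom_row_sum hω hωρ (k - i)) (mul_nonneg hC hD0)
    calc ∑ j ∈ Ico i k, M k j * lam j i ≤ C * D * (ω / (ρ - ω) * ρ ^ (k - i)) := by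
          rw [step2] at step1; exact step1.trans step3
      _ = C * D * (ω / (ρ - ω)) * ρ ^ (k - i) := by ring
  calc Λ k i ≤ (if i = k then ℓ else 0) + ∑ j ∈ Ico i k, M k j * lam j i := h1
    _ ≤ ℓ * ρ ^ (k - i) + C * D * (ω / (ρ - ω)) * ρ ^ (k - i) := add_le_add hdiag hsum
    _ = (ℓ + C * D * (ω / (ρ - ω))) * ρ ^ (k - i) := by ring
    _ = (ℓ + C * (ℓ' * (ρ - ω) / (ρ - (1 + C') * ω)) * (ω / (ρ - ω))) * ρ ^ (k - i) := by rw [hD]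

/-- CONSISTENCY OF THE SHAPES (non-vacuity of the hypotheses of bridge (b) in the intended regime): the diagonal data
`Λ k i = lam k i = ℓ·[i = k]`, zero memories, satisfy `ModuliDecomposition`, `ModuliRenewal` and both `FadingMemory`
hypotheses (with C = C' = 0) — the last-only families of `T4CouplingMatching.fadingMemory_diag`. [folklore] -/
theorem shapes_diag_witness (ℓ ω : ℝ) :
    ModuliDecomposition (fun k i => if i = k then ℓ else 0) (fun k i => if i = k then ℓ else 0) (fun _ _ => 0) ℓ ∧
    ModuliRenewal (fun k i => if i = k then ℓ else 0) (fun _ _ => 0) ℓ ∧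
    FadingMemory 0 ω (fun _ _ => (0 : ℝ)) := by
  refine ⟨?_, ⟨?_, ?_⟩, ?_⟩
  · intro k i _
    simp
  · intro i
    simp
  · intro j i hij
    have : i ≠ j := Nat.ne_of_lt hij
    simp [this]
  · intro k i _
    simp

end Literature.MathematicalPhysics.QuantumFieldTheory.Balaban1983to89.T4BetaMemory
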